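import Literature.AnabelianGeometry.SemiGraphs.ProSigmaCompletionQuotients
import Literature.GroupTheory.CombinatorialGroupTheory.PuncturedSurfaceGroupCuspQuotients

/-!
# Uniform cusp-order open normal subgroups of a pro-`Σ` surface group ([SemiAnbd] Ex. 2.10)

Mochizuki, *Semi-graphs of anabelioids*, Publ. RIMS **42** (2006), Example 2.10 p. 31: the
semi-graph of anabelioids of a pointed stable curve — each `Π_v` "the maximal pro-`Σ` quotient of
the fundamental group of a hyperbolic Riemann surface of finite type", each `Π_b → Π_v` "the
inclusion morphism of the inertia group of one of the cusps" — "is coherent, totally elevated, …"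
("one verifies immediately … from the well-known structure of fundamental groups of hyperbolic
Riemann surfaces of finite type") [cite: MochizukiSemiAnbd2006, Ex. 2.10 p.31].  The approximators
(finite quotients `Π_v ↠ F_v` of bounded order, [SemiAnbd] Def. 2.3) that coherence and total
elevation ask for must induce on the inertia group of a node the SAME finite quotient from both of
its branches.  This proof-only file (cell abc-iut, layer L3, row G31 (1)–(3), seat abc-iut-L3-t4)
supplies the profinite-level input over abc-iut-L3-t1's interface
`SemiGraphOfAnabelioids.IsProSigmaCompletion` (`Coverticial.lean`): for `ι : Γ_{g,r} → P` a pro-`Σ`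
completion of a hyperbolic punctured surface group, every `Σ`-integer `n` and every open normal
`U₀ ⊴ P` containing the `ι(c_j)^n`, there is an open normal `W ⊆ U₀` of index dividing
`[P : U₀] · n³` meeting the closure of EVERY cusp inertia group `ι(⟨c_j⟩)` in exactly the closure
of `ι(⟨c_j ^ n⟩)` (`exists_open_normal_inter_closure_cuspInertia`), from the discrete statement
`PuncturedSurfaceGroup.exists_normal_le_inf_cuspInertia_eq`.  Plain profinite group theory; no
statement here takes a side on any disputed claim.
-/

namespace Literature.AnabelianGeometry.SemiGraphs.SemiGraphOfAnabelioids.IsProSigmaCompletion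

open Literature.AnabelianGeometry.Anabelioids Topology
open Literature.GroupTheory.CombinatorialGroupTheory
open Literature.GroupTheory.CombinatorialGroupTheory.PuncturedSurfaceGroup

variable {Sigma : Set ℕ} {g r : ℕ} {P : Type*} [Group P] [TopologicalSpace P]
  [IsTopologicalGroup P] [CompactSpace P] [TotallyDisconnectedSpace P]
  {ι : PuncturedSurfaceGroup g r →* P}

omit [CompactSpace P] [TotallyDisconnectedSpace P] in
/-- For an open subgroup `W` with `ι⁻¹(W) = N` and any subgroup `C ⊆ Γ`:
`W ∩ (ι(C))⁻ = (ι(C ∩ N))⁻` — the open set `W` meets the closure of `ι(C)` inside the closure of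
`W ∩ ι(C) = ι(C ∩ N)`, and `W` is closed. [cite: MochizukiSemiAnbd2006, Ex. 2.10 p.31] -/
theorem inter_closure_image_eq {Γ : Type*} [Group Γ] {ι : Γ →* P} (W : Subgroup P)
    (hW : IsOpen (W : Set P)) (C : Subgroup Γ) :
    (W : Set P) ∩ closure (ι '' (C : Set Γ)) = closure (ι '' ((C ⊓ W.comap ι : Subgroup Γ) : Set Γ)) := by
  apply Set.Subset.antisymm
  · refine (hW.inter_closure).trans (closure_mono ?_)
    rintro x ⟨hxW, γ, hγ, rfl⟩
    exact ⟨γ, ⟨hγ, hxW⟩, rfl⟩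
  · refine closure_minimal ?_ ((W.isClosed_of_isOpen hW).inter isClosed_closure)
    rintro _ ⟨γ, ⟨hγC, hγW⟩, rfl⟩
    exact ⟨hγW, subset_closure ⟨γ, hγC, rfl⟩⟩

/-- **Uniform cusp-order open normal subgroups.** Let `ι : Γ_{g,r} → P` be a pro-`Σ` completion of a
hyperbolic punctured surface group (`P` profinite), `n` a `Σ`-integer and `U₀ ⊴ P` an open normal
subgroup containing every `ι(c_j)^n`.  Then there is an open normal subgroup `W ⊆ U₀` of `P` of index
dividing `[P : U₀] · n ^ 3` with `W ∩ (ι⟨c_j⟩)⁻ = (ι⟨c_j ^ n⟩)⁻` for EVERY cusp `j`: a finite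
quotient of `P` below `P/U₀` in which all the (closed) cusp inertia groups have image `ℤ/n`.
[cite: MochizukiSemiAnbd2006, Ex. 2.10 p.31] -/
theorem exists_open_normal_inter_closure_cuspInertia (hι : IsProSigmaCompletion Sigma ι)
    (h : IsHyperbolicType g r) {n : ℕ} (hn : IsSigmaInteger Sigma n) (U₀ : Subgroup P) [U₀.Normal]
    (hU₀ : IsOpen (U₀ : Set P)) (hc : ∀ j, ι (c j) ^ n ∈ U₀) :
    ∃ W : Subgroup P, IsOpen (W : Set P) ∧ W.Normal ∧ W ≤ U₀ ∧ W.index ∣ U₀.index * n ^ 3 ∧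
      ∀ j, (W : Set P) ∩
          closure (ι '' ((cuspInertia (g := g) j : Subgroup (PuncturedSurfaceGroup g r)) :
            Set (PuncturedSurfaceGroup g r))) =
        closure (ι '' ((Subgroup.zpowers (c (g := g) j ^ n) :
          Subgroup (PuncturedSurfaceGroup g r)) : Set (PuncturedSurfaceGroup g r))) := by
  -- the discrete statement inside `N₀ := ι⁻¹(U₀)`
  haveI : (U₀.comap ι).Normal := inferInstance
  have hc' : ∀ j, c j ^ n ∈ U₀.comap ι := fun j => by
    rw [Subgroup.mem_comap, map_pow]; exact hc j
  obtain ⟨N, hNle, hNn, hNidx, hNcusp⟩ :=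
    exists_normal_le_inf_cuspInertia_eq (g := g) h hn.1 (U₀.comap ι) hc'
  haveI := hNn
  -- `N` has `Σ`-integer index, hence is the pull-back of an open subgroup `W`
  have hN₀idx : (U₀.comap ι).index = U₀.index := index_comap_of_normal hι U₀ hU₀
  have hNS : IsSigmaInteger Sigma N.index :=
    ((isSigmaInteger_index_comap hι U₀ hU₀).mul (hn.mul (hn.mul hn))).of_dvd
      (by simpa [pow_succ, mul_assoc] using hNidx)
  obtain ⟨W, hWo, hWN⟩ := hι.comap_surj N hNn hNS
  have hWn : W.Normal := normal_of_comap_normal hι W hWo (hWN ▸ hNn)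
  haveI := hWn
  refine ⟨W, hWo, hWn, ?_, ?_, fun j => ?_⟩
  · exact le_of_comap_le hι hWo hU₀ (hWN ▸ hNle)
  · rw [← index_comap_of_normal hι W hWo, hWN, ← hN₀idx]
    exact hNidx
  · rw [inter_closure_image_eq W hWo, hWN, inf_comm, hNcusp j]

/-! ### Topological finite generation (the `Π_v`-clause of coherence, [SemiAnbd] Def. 2.3 (iii)) -/

omit [CompactSpace P] [TotallyDisconnectedSpace P] in
/-- A pro-`Σ` completion of `Γ_{g,r}` is topologically finitely generated (by the images of the
`2g + r` generators, `ι(Γ)` being dense): the `Π_v`-clause of "coherent" ([SemiAnbd] Def. 2.3 (iii))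
for a vertex of surface type. [cite: MochizukiSemiAnbd2006, Ex. 2.10 p.31] -/
theorem isTopologicallyFinitelyGenerated (hι : IsProSigmaCompletion Sigma ι) :
    AbsoluteAnabelian.IsTopologicallyFinitelyGenerated P := by
  classical
  refine ⟨⟨(Finset.univ : Finset (puncturedSurfaceGen g r)).image
    (fun a => ι (PresentedGroup.of a)), ?_⟩⟩
  have hcl : Subgroup.closure
      (((Finset.univ : Finset (puncturedSurfaceGen g r)).image
        (fun a => ι (PresentedGroup.of a)) : Finset P) : Set P) = ι.range := by
    rw [Finset.coe_image, Finset.coe_univ, Set.image_univ,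
      show (Set.range fun a => ι (PresentedGroup.of a)) =
        ι '' Set.range (PresentedGroup.of : puncturedSurfaceGen g r → PuncturedSurfaceGroup g r)
        from Set.range_comp ι PresentedGroup.of,
      ← MonoidHom.map_closure, PresentedGroup.closure_range_of, ← MonoidHom.range_eq_map]
  rw [hcl]
  apply SetLike.coe_injective
  rw [Subgroup.topologicalClosure_coe, Subgroup.coe_top, MonoidHom.coe_range]
  exact hι.dense.closure_eq

omit [CompactSpace P] [TotallyDisconnectedSpace P] in
/-- For a cyclic subgroup `⟨γ⟩ ⊆ Γ`: the closure of `ι⟨γ ^ n⟩` is the closure of the `n`-th powers of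
the closure of `ι⟨γ⟩` (continuity of `x ↦ x ^ n`) — so "the index-`n` part" of a closed procyclic
branch group is intrinsic. [cite: MochizukiSemiAnbd2006, Ex. 2.10 p.31] -/
theorem closure_image_zpowers_pow {Γ : Type*} [Group Γ] (ι : Γ →* P) (γ : Γ) (n : ℕ) :
    closure (ι '' ((Subgroup.zpowers (γ ^ n) : Subgroup Γ) : Set Γ)) =
      closure ((fun x : P => x ^ n) '' closure (ι '' ((Subgroup.zpowers γ : Subgroup Γ) : Set Γ))) := by
  apply Set.Subset.antisymm
  · refine closure_mono ?_
    rintro _ ⟨_, ⟨k, rfl⟩, rfl⟩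
    refine ⟨ι (γ ^ k), subset_closure ⟨γ ^ k, ⟨k, rfl⟩, rfl⟩, ?_⟩
    dsimp only
    rw [← map_pow, ← zpow_natCast, ← zpow_natCast, ← zpow_mul, ← zpow_mul, mul_comm]
  · refine closure_minimal ?_ isClosed_closure
    refine (image_closure_subset_closure_image (continuous_pow n)).trans (closure_mono ?_)
    rintro _ ⟨_, ⟨_, ⟨k, rfl⟩, rfl⟩, rfl⟩
    refine ⟨(γ ^ n) ^ k, ⟨k, rfl⟩, ?_⟩
    dsimp only
    rw [← map_pow, ← zpow_natCast, ← zpow_natCast, ← zpow_mul, ← zpow_mul, mul_comm]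

end Literature.AnabelianGeometry.SemiGraphs.SemiGraphOfAnabelioids.IsProSigmaCompletion

/-! ### At a vertex of surface type -/

namespace Literature.AnabelianGeometry.SemiGraphs.SemiGraphOfAnabelioids

open CategoryTheory CategoryTheory.PreGaloisCategory
open Literature.AnabelianGeometry.Anabelioids
open Literature.GroupTheory.CombinatorialGroupTheory

universe v₁ u₁ u

/-- **The `Π_v`-clause of coherence at a surface-type vertex**: for `𝒢` of surface type
([SemiAnbd] Ex. 2.10), every vertex group `Π_v = Aut F` is topologically finitely generated
(`IsCoherent.fg_V`). [cite: MochizukiSemiAnbd2006, Ex. 2.10 p.31] -/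
theorem IsOfSurfaceType.isTopologicallyFinitelyGenerated_piV {𝒢 : SemiGraphOfAnabelioids.{v₁, u₁, u}}
    {Sigma : Set ℕ} (hS : 𝒢.IsOfSurfaceType Sigma) (v : 𝒢.graph.Vertex)
    (F : 𝒢.V v ⥤ FintypeCat.{v₁}) [FiberFunctor F] :
    AbsoluteAnabelian.IsTopologicallyFinitelyGenerated (Aut F) := by
  obtain ⟨g, r, ι, -, hι, -⟩ := hS.vertex v F
  exact hι.isTopologicallyFinitelyGenerated

/-- **Uniform branch-order open normal subgroups at a surface-type vertex.** For `𝒢` of surface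
type, a vertex `v` with basepoint `F`, a `Σ`-integer `n` and an open normal `U₀ ⊴ Π_v = Aut F`
containing all `n`-th powers, there is an open normal `W ⊆ U₀` of index dividing `[Π_v : U₀] · n³`
meeting EVERY branch subgroup `Π_b ⊆ Π_v` (`b` abutting to `v`, any basepoint of `𝒢_e`, the
representative `Π_b` supplied by the surface structure) in exactly the closure of its `n`-th powers
— the input for building approximators of `𝒢` inducing `ℤ/n` on every edge group from both ends
([SemiAnbd] Ex. 2.10: coherent, totally elevated). [cite: MochizukiSemiAnbd2006, Ex. 2.10 p.31] -/
theorem IsOfSurfaceType.exists_open_normal_inter_branchSubgroup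
    {𝒢 : SemiGraphOfAnabelioids.{v₁, u₁, u}} {Sigma : Set ℕ} (hS : 𝒢.IsOfSurfaceType Sigma)
    (v : 𝒢.graph.Vertex) (F : 𝒢.V v ⥤ FintypeCat.{v₁}) [FiberFunctor F] {n : ℕ}
    (hn : IsSigmaInteger Sigma n) (U₀ : Subgroup (Aut F)) [U₀.Normal] (hU₀ : IsOpen (U₀ : Set (Aut F)))
    (hpow : ∀ x : Aut F, x ^ n ∈ U₀) :
    ∃ W : Subgroup (Aut F), IsOpen (W : Set (Aut F)) ∧ W.Normal ∧ W ≤ U₀ ∧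
      W.index ∣ U₀.index * n ^ 3 ∧
      ∀ (b : {b : 𝒢.graph.Branch // 𝒢.graph.abuts b = some v})
        (Fe : 𝒢.E (𝒢.graph.edgeOf b.1) ⥤ FintypeCat.{v₁}) [FiberFunctor Fe],
        ∃ α : (𝒢.pull b.1 v b.2).pullback ⋙ Fe ≅ F,
          (W : Set (Aut F)) ∩ (𝒢.branchSubgroup F b.1 b.2 Fe α : Set (Aut F)) =
            closure ((fun x : Aut F => x ^ n) '' (𝒢.branchSubgroup F b.1 b.2 Fe α : Set (Aut F))) := by
  obtain ⟨g, r, ι, hh, hι, js, -, hbr⟩ := hS.vertex v F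
  obtain ⟨W, hWo, hWn, hWle, hWidx, hWcusp⟩ :=
    hι.exists_open_normal_inter_closure_cuspInertia hh hn U₀ hU₀ (fun j => hpow _)
  refine ⟨W, hWo, hWn, hWle, hWidx, fun b Fe _ => ?_⟩
  obtain ⟨α, hα⟩ := hbr b Fe
  refine ⟨α, ?_⟩
  rw [hα, hWcusp (js b), PuncturedSurfaceGroup.cuspInertia]
  exact IsProSigmaCompletion.closure_image_zpowers_pow ι _ n

end Literature.AnabelianGeometry.SemiGraphs.SemiGraphOfAnabelioids
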